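import Summits.AtomisticToContinuum.Crystallization.Theorems.ExcessDecayLiouvilleLinearisation
import Summits.AtomisticToContinuum.Crystallization.Theorems.ExcessDecayLiouvilleHcpLiouvilleDefs
import Summits.AtomisticToContinuum.Crystallization.Theorems.ExcessDecayLiouvilleLatticeSums

/-!
# `ExcessDecayLiouville.HcpLiouville` (stmt-AtomisticToContinuum-9332), line `Sketch`: pair calculus for the linear Caccioppoli step

Per-bond (finite-dimensional) calculus behind stub `stub_flatDifferences` (level 2 of the two-level
Caccioppoli argument): the Lennard-Jones force-constant form `Hess₀ e w = wᵀK(e)w` of the route's mirror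
file is a quadratic form in `w` for every bond vector `e`; its polarisation
`B_e(ξ, η) = (Hess₀ e (ξ + η) − Hess₀ e (ξ − η))/4` is the differential of the pair force
`F(e) = (V′(|e|)/|e|)·e`, so that along a chord `θ ↦ a + θδ` avoiding the origin

* `inner_force_sub_force_eq` : `⟪F(a + δ) − F(a), η⟫ = (secHess a δ (δ + η) − secHess a δ (δ − η))/4`
  (fundamental theorem of calculus; `secHess a δ w = ∫₀¹ Hess₀ (a + θδ) w dθ` is the line vocabulary's
  secant form);
* `flatDiff_secHess_cutoff_identity` : the discrete product rule of the Caccioppoli trick,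
  `secHess a δ (αx − βy) = ⟪F(a+δ) − F(a), α²x − β²y⟫ + ¼(α − β)² (secHess a δ (x + y) − secHess a δ (x − y))`
  for `δ = x − y`;
* `flatDiff_abs_Hess₀_chord_le`, `flatDiff_abs_secHess_chord_le` : from `|Hess₀ e w| ≤ 904‖e‖⁻⁸‖w‖²`
  (`‖e‖ ≥ 1/2`, `ExcessDecayLiouvilleLatticeSums.abs_Hess₀_le'`) the `O(‖e‖⁻⁸)` bounds along chords that stay within `‖e‖/10` of a bond
  `e` of length `≥ 23/25`;
* `continuousAt_Hess₀_left` : continuity of `e ↦ Hess₀ e w` away from `0`.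

All `[folklore]`; a `--supports` helper for item stmt-AtomisticToContinuum-9332, nothing here closes an
item.
-/

noncomputable section

namespace Summit.AtomisticToContinuum.Crystallization.Theorems.ExcessDecayLiouville

open scoped BigOperators Topology Classical InnerProductSpace
open Literature.MathematicalPhysics.StatisticalMechanics
open Summit.AtomisticToContinuum.Crystallization.Theses.ExcessDecayLiouville
open Summit.AtomisticToContinuum.Crystallization.Theorems.PhononStabilityNegative

/-! ## `Hess₀ e` is a quadratic form -/

/-- `wᵀK(e)w = P(e)⟪e,w⟫² + Q(e)‖w‖²` with `P = (V″(r) − V′(r)/r)/r²`, `Q = V′(r)/r`, `r = ‖e‖`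
(valid for every `e`, junk values included). [folklore] -/
private theorem Hess₀_eq_quad (e w : (EuclideanSpace ℝ (Fin 3))) :
    Hess₀ e w = (deriv (deriv lennardJones) ‖e‖ - deriv lennardJones ‖e‖ / ‖e‖) / ‖e‖ ^ 2 * ⟪e, w⟫_ℝ ^ 2
      + deriv lennardJones ‖e‖ / ‖e‖ * ‖w‖ ^ 2 := by
  unfold Hess₀
  rw [div_pow]
  ring

/-- **Polarisation** of the force-constant form: `(Hess₀ e (ξ+η) − Hess₀ e (ξ−η))/4 = P⟪e,ξ⟫⟪e,η⟫ + Q⟪ξ,η⟫`.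
[folklore] -/
private theorem Hess₀_polar (e ξ η : (EuclideanSpace ℝ (Fin 3))) :
    (Hess₀ e (ξ + η) - Hess₀ e (ξ - η)) / 4 =
      (deriv (deriv lennardJones) ‖e‖ - deriv lennardJones ‖e‖ / ‖e‖) / ‖e‖ ^ 2 * (⟪e, ξ⟫_ℝ * ⟪e, η⟫_ℝ)
        + deriv lennardJones ‖e‖ / ‖e‖ * ⟪ξ, η⟫_ℝ := by
  rw [Hess₀_eq_quad, Hess₀_eq_quad, inner_add_right, inner_sub_right, norm_add_sq_real,
    norm_sub_sq_real]
  ring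

/-- **The discrete product rule of the Caccioppoli trick** at the level of one bond and one frozen
force-constant form: for scalars `α, β` (cut-off values at the two ends) and vectors `x, y` (the field at
the two ends), with `δ = x − y`,
`Hess₀ e (αx − βy) = B_e(δ, α²x − β²y) + ¼(α−β)² (Hess₀ e (x+y) − Hess₀ e (x−y))`. [folklore] -/
private theorem Hess₀_cutoff_identity (e x y : (EuclideanSpace ℝ (Fin 3))) (α β : ℝ) :
    Hess₀ e (α • x - β • y) =
      (Hess₀ e ((x - y) + (α ^ 2 • x - β ^ 2 • y)) - Hess₀ e ((x - y) - (α ^ 2 • x - β ^ 2 • y))) / 4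
        + (α - β) ^ 2 / 4 * (Hess₀ e (x + y) - Hess₀ e (x - y)) := by
  rw [Hess₀_polar]
  simp only [Hess₀_eq_quad, ← real_inner_self_eq_norm_sq, inner_add_left, inner_add_right,
    inner_sub_left, inner_sub_right, real_inner_smul_left, real_inner_smul_right, real_inner_comm y x]
  ring

/-! ## Bounds -/

/-- **Chords stay near the bond**: if `‖e‖ ≥ 23/25` and `‖d₀‖, ‖d₁‖ ≤ 1/20`, then every point of the
chord from `e + d₀` to `e + d₁` has norm `≥ (9/10)‖e‖`. [folklore] -/
theorem flatDiff_chord_norm_ge {e d₀ d₁ : (EuclideanSpace ℝ (Fin 3))} (he : 23 / 25 ≤ ‖e‖) (h₀ : ‖d₀‖ ≤ 1 / 20) (h₁ : ‖d₁‖ ≤ 1 / 20)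
    {θ : ℝ} (hθ : θ ∈ Set.Icc (0 : ℝ) 1) :
    9 / 10 * ‖e‖ ≤ ‖(e + d₀) + θ • (d₁ - d₀)‖ := by
  have hsplit : (e + d₀) + θ • (d₁ - d₀) = e + ((1 - θ) • d₀ + θ • d₁) := by module
  rw [hsplit]
  have hsmall : ‖(1 - θ) • d₀ + θ • d₁‖ ≤ 1 / 20 := by
    have h1 : ‖(1 - θ) • d₀‖ ≤ (1 - θ) * (1 / 20) := by
      rw [norm_smul, Real.norm_eq_abs, abs_of_nonneg (by linarith [hθ.2])]
      exact mul_le_mul_of_nonneg_left h₀ (by linarith [hθ.2])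
    have h2 : ‖θ • d₁‖ ≤ θ * (1 / 20) := by
      rw [norm_smul, Real.norm_eq_abs, abs_of_nonneg hθ.1]
      exact mul_le_mul_of_nonneg_left h₁ hθ.1
    calc ‖(1 - θ) • d₀ + θ • d₁‖ ≤ ‖(1 - θ) • d₀‖ + ‖θ • d₁‖ := norm_add_le _ _
      _ ≤ (1 - θ) * (1 / 20) + θ * (1 / 20) := add_le_add h1 h2
      _ = 1 / 20 := by ring
  have h3 := norm_sub_norm_le e (-((1 - θ) • d₀ + θ • d₁))
  rw [sub_neg_eq_add, norm_neg] at h3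
  linarith

/-- **The force-constant form along a chord is `O(‖e‖⁻⁸)`**: if the point `a'` satisfies
`(9/10)‖e‖ ≤ ‖a'‖` for a bond `e` of length `≥ 23/25`, then `|Hess₀ a' ξ| ≤ 904(10/9)⁸‖e‖⁻⁸‖ξ‖²`.
[folklore] -/
theorem flatDiff_abs_Hess₀_chord_le {e a' : (EuclideanSpace ℝ (Fin 3))} (ξ : (EuclideanSpace ℝ (Fin 3))) (he : 23 / 25 ≤ ‖e‖) (ha : 9 / 10 * ‖e‖ ≤ ‖a'‖) :
    |Hess₀ a' ξ| ≤ 904 * (10 / 9) ^ 8 * (‖e‖⁻¹) ^ 8 * ‖ξ‖ ^ 2 := by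
  have he0 : 0 < ‖e‖ := by linarith
  have hhalf : (1 / 2 : ℝ) ≤ ‖a'‖ := by linarith
  have ha0 : 0 < 9 / 10 * ‖e‖ := by positivity
  have hinv : ‖a'‖⁻¹ ≤ (9 / 10 * ‖e‖)⁻¹ := inv_anti₀ ha0 ha
  have hpow : (‖a'‖⁻¹) ^ 8 ≤ ((9 / 10 * ‖e‖)⁻¹) ^ 8 :=
    pow_le_pow_left₀ (inv_nonneg.2 (norm_nonneg _)) hinv 8
  have hid : ((9 / 10 * ‖e‖)⁻¹) ^ 8 = (10 / 9) ^ 8 * (‖e‖⁻¹) ^ 8 := by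
    rw [mul_inv, mul_pow]; norm_num
  calc |Hess₀ a' ξ| ≤ 904 * (‖a'‖⁻¹) ^ 8 * ‖ξ‖ ^ 2 := abs_Hess₀_le' hhalf ξ
    _ ≤ 904 * ((9 / 10 * ‖e‖)⁻¹) ^ 8 * ‖ξ‖ ^ 2 := by gcongr
    _ = 904 * (10 / 9) ^ 8 * (‖e‖⁻¹) ^ 8 * ‖ξ‖ ^ 2 := by rw [hid]; ring

/-- **The secant form along a chord is `O(‖e‖⁻⁸)`**: if every point `a + θδ`, `θ ∈ [0,1]`, of the chord
has norm `≥ (9/10)‖e‖` for a bond `e` of length `≥ 23/25`, then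
`|secHess a δ ξ| ≤ 904(10/9)⁸‖e‖⁻⁸‖ξ‖²`. [folklore] -/
theorem flatDiff_abs_secHess_chord_le {e a δ : (EuclideanSpace ℝ (Fin 3))} (ξ : (EuclideanSpace ℝ (Fin 3))) (he : 23 / 25 ≤ ‖e‖)
    (hch : ∀ θ ∈ Set.Icc (0 : ℝ) 1, 9 / 10 * ‖e‖ ≤ ‖a + θ • δ‖) :
    |secHess a δ ξ| ≤ 904 * (10 / 9) ^ 8 * (‖e‖⁻¹) ^ 8 * ‖ξ‖ ^ 2 := by
  unfold secHess
  have h := intervalIntegral.norm_integral_le_of_norm_le_const (a := (0 : ℝ)) (b := 1)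
    (f := fun θ => Hess₀ (a + θ • δ) ξ) (C := 904 * (10 / 9) ^ 8 * (‖e‖⁻¹) ^ 8 * ‖ξ‖ ^ 2) ?_
  · simpa using h
  · intro θ hθ
    rw [Set.uIoc_of_le zero_le_one] at hθ
    rw [Real.norm_eq_abs]
    exact flatDiff_abs_Hess₀_chord_le ξ he (hch θ ⟨hθ.1.le, hθ.2⟩)

/-! ## Continuity of the force-constant form in the bond vector -/

/-- `V′` is continuous away from `0`. [folklore] -/
private theorem continuousAt_deriv_lennardJones {r : ℝ} (hr : r ≠ 0) :
    ContinuousAt (deriv lennardJones) r := by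
  have hev : (fun y : ℝ => -(y⁻¹) ^ 13 + (y⁻¹) ^ 7) =ᶠ[𝓝 r] deriv lennardJones := by
    filter_upwards [eventually_ne_nhds hr] with y hy using (deriv_lennardJones hy).symm
  have hc : ContinuousAt (fun y : ℝ => y⁻¹) r := continuousAt_inv₀ hr
  exact ((hc.pow 13).neg.add (hc.pow 7)).congr hev

/-- `V″` is continuous away from `0`. [folklore] -/
private theorem continuousAt_deriv_deriv_lennardJones {r : ℝ} (hr : r ≠ 0) :
    ContinuousAt (deriv (deriv lennardJones)) r := by
  have hev : (fun y : ℝ => 13 * (y⁻¹) ^ 14 - 7 * (y⁻¹) ^ 8) =ᶠ[𝓝 r] deriv (deriv lennardJones) := by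
    filter_upwards [eventually_ne_nhds hr] with y hy using (deriv_deriv_lennardJones hy).symm
  have hc : ContinuousAt (fun y : ℝ => y⁻¹) r := continuousAt_inv₀ hr
  exact (((hc.pow 14).const_mul 13).sub ((hc.pow 8).const_mul 7)).congr hev

/-- `e ↦ wᵀK(e)w` is continuous at every `e ≠ 0`. [folklore] -/
private theorem continuousAt_Hess₀_left (w : (EuclideanSpace ℝ (Fin 3))) {e₀ : (EuclideanSpace ℝ (Fin 3))} (h : e₀ ≠ 0) :
    ContinuousAt (fun e : (EuclideanSpace ℝ (Fin 3)) => Hess₀ e w) e₀ := by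
  have hr : ‖e₀‖ ≠ 0 := norm_ne_zero_iff.2 h
  have hn : ContinuousAt (fun e : (EuclideanSpace ℝ (Fin 3)) => ‖e‖) e₀ := continuous_norm.continuousAt
  have hi : ContinuousAt (fun e : (EuclideanSpace ℝ (Fin 3)) => ⟪e, w⟫_ℝ) e₀ := (continuous_id.inner continuous_const).continuousAt
  have h1 : ContinuousAt (fun e : (EuclideanSpace ℝ (Fin 3)) => deriv (deriv lennardJones) ‖e‖) e₀ :=
    (continuousAt_deriv_deriv_lennardJones hr).comp hn
  have h2 : ContinuousAt (fun e : (EuclideanSpace ℝ (Fin 3)) => deriv lennardJones ‖e‖) e₀ :=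
    (continuousAt_deriv_lennardJones hr).comp hn
  have h3 : ContinuousAt (fun e : (EuclideanSpace ℝ (Fin 3)) => ⟪e, w⟫_ℝ / ‖e‖) e₀ := hi.div hn hr
  have h4 : ContinuousAt (fun e : (EuclideanSpace ℝ (Fin 3)) => deriv lennardJones ‖e‖ / ‖e‖) e₀ := h2.div hn hr
  show ContinuousAt (fun e : (EuclideanSpace ℝ (Fin 3)) => deriv (deriv lennardJones) ‖e‖ * (⟪e, w⟫_ℝ / ‖e‖) ^ 2 +
    deriv lennardJones ‖e‖ / ‖e‖ * (‖w‖ ^ 2 - (⟪e, w⟫_ℝ / ‖e‖) ^ 2)) e₀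
  exact (h1.mul (h3.pow 2)).add (h4.mul (continuousAt_const.sub (h3.pow 2)))

/-- Continuity of `θ ↦ Hess₀ (a + θδ) ξ` wherever the chord avoids the origin. [folklore] -/
theorem flatDiff_continuousAt_Hess₀_chord (a δ ξ : (EuclideanSpace ℝ (Fin 3))) {θ : ℝ} (h : a + θ • δ ≠ 0) :
    ContinuousAt (fun θ : ℝ => Hess₀ (a + θ • δ) ξ) θ := by
  have h1 : ContinuousAt (fun θ : ℝ => a + θ • δ) θ := by fun_prop
  exact ContinuousAt.comp (f := fun θ : ℝ => a + θ • δ) (g := fun e : (EuclideanSpace ℝ (Fin 3)) => Hess₀ e ξ)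
    (continuousAt_Hess₀_left ξ h) h1

/-- Interval integrability on `[0,1]` of `θ ↦ Hess₀ (a + θδ) ξ` for a chord avoiding the origin.
[folklore] -/
private theorem intervalIntegrable_Hess₀_chord (a δ ξ : (EuclideanSpace ℝ (Fin 3))) (h0 : ∀ θ ∈ Set.Icc (0 : ℝ) 1, a + θ • δ ≠ 0) :
    IntervalIntegrable (fun θ : ℝ => Hess₀ (a + θ • δ) ξ) MeasureTheory.volume 0 1 := by
  refine ContinuousOn.intervalIntegrable ?_
  rw [Set.uIcc_of_le zero_le_one]
  exact fun θ hθ => (flatDiff_continuousAt_Hess₀_chord a δ ξ (h0 θ hθ)).continuousWithinAt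

/-! ## The pair force and its differential along a chord -/

/-- **Fundamental theorem of calculus for the pair force along a chord**: if `a + θδ ≠ 0` for
`θ ∈ [0,1]`, then for every `η`,
`⟪F(a + δ) − F(a), η⟫ = (secHess a δ (δ + η) − secHess a δ (δ − η))/4`, `F(e) = (V′(|e|)/|e|)·e`,
i.e. the θ-averaged polarised force-constant form is the exact secant of the force. [folklore] -/
private theorem inner_force_sub_force_eq (a δ η : (EuclideanSpace ℝ (Fin 3))) (h0 : ∀ θ ∈ Set.Icc (0 : ℝ) 1, a + θ • δ ≠ 0) :
    ⟪(deriv lennardJones ‖a + δ‖ / ‖a + δ‖) • (a + δ) - (deriv lennardJones ‖a‖ / ‖a‖) • a, η⟫_ℝ =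
      (secHess a δ (δ + η) - secHess a δ (δ - η)) / 4 := by
  -- the scalar function, its explicit smooth form, and the claimed derivative
  set g : ℝ → ℝ := fun θ => ⟪(deriv lennardJones ‖a + θ • δ‖ / ‖a + θ • δ‖) • (a + θ • δ), η⟫_ℝ
    with hg
  set P : ℝ → ℝ := fun θ => ‖a‖ ^ 2 + 2 * ⟪a, δ⟫_ℝ * θ + ‖δ‖ ^ 2 * θ ^ 2 with hP
  set gs : ℝ → ℝ := fun θ => (-((P θ)⁻¹) ^ 7 + ((P θ)⁻¹) ^ 4) * (⟪a, η⟫_ℝ + θ * ⟪δ, η⟫_ℝ) with hgs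
  set k : ℝ → ℝ := fun θ => (Hess₀ (a + θ • δ) (δ + η) - Hess₀ (a + θ • δ) (δ - η)) / 4 with hk
  have hx : ∀ θ : ℝ, ‖a + θ • δ‖ ^ 2 = P θ := by
    intro θ
    rw [hP, norm_add_sq_real, inner_smul_right, norm_smul, Real.norm_eq_abs, mul_pow, sq_abs]
    ring
  -- `g = gs` wherever the chord avoids the origin
  have hggs : ∀ θ : ℝ, a + θ • δ ≠ 0 → g θ = gs θ := by
    intro θ hθ
    simp only [hg, hgs]
    rw [ljForce_eq_smul hθ, real_inner_smul_left, hx θ, inner_add_left, real_inner_smul_left]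
  -- the open set of good parameters
  have hopen : IsOpen {θ : ℝ | a + θ • δ ≠ 0} :=
    isOpen_ne_fun (by fun_prop) continuous_const
  -- derivative of `g`
  have hderiv : ∀ θ₀ : ℝ, a + θ₀ • δ ≠ 0 → HasDerivAt g (k θ₀) θ₀ := by
    intro θ₀ hθ₀
    have hr : ‖a + θ₀ • δ‖ ≠ 0 := norm_ne_zero_iff.2 hθ₀
    have hP0 : P θ₀ ≠ 0 := by rw [← hx θ₀]; exact pow_ne_zero 2 hr
    -- derivative of the polynomial `P`
    have hdP : HasDerivAt P (2 * ⟪a, δ⟫_ℝ + ‖δ‖ ^ 2 * (2 * θ₀)) θ₀ := by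
      have h := ((hasDerivAt_const θ₀ (‖a‖ ^ 2)).add
        ((hasDerivAt_id θ₀).const_mul (2 * ⟪a, δ⟫_ℝ))).add
        (((hasDerivAt_id θ₀).pow 2).const_mul (‖δ‖ ^ 2))
      refine (h.congr_of_eventuallyEq (Filter.Eventually.of_forall fun θ => ?_)).congr_deriv ?_
      · simp only [hP, Pi.add_apply, Pi.pow_apply, id]
      · simp only [id, Nat.cast_ofNat, pow_one, mul_one, zero_add, Nat.add_one_sub_one]
    -- derivative of `h ∘ P`
    have hdh := (hasDerivAt_ljProfile hP0).comp θ₀ hdP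
    -- derivative of the linear factor
    have hdl : HasDerivAt (fun θ : ℝ => ⟪a, η⟫_ℝ + θ * ⟪δ, η⟫_ℝ) ⟪δ, η⟫_ℝ θ₀ := by
      simpa using ((hasDerivAt_id θ₀).mul_const ⟪δ, η⟫_ℝ).const_add ⟪a, η⟫_ℝ
    have hdgs : HasDerivAt gs ((7 * ((P θ₀)⁻¹) ^ 8 - 4 * ((P θ₀)⁻¹) ^ 5) *
        (2 * ⟪a, δ⟫_ℝ + ‖δ‖ ^ 2 * (2 * θ₀)) * (⟪a, η⟫_ℝ + θ₀ * ⟪δ, η⟫_ℝ) +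
        (-((P θ₀)⁻¹) ^ 7 + ((P θ₀)⁻¹) ^ 4) * ⟪δ, η⟫_ℝ) θ₀ := by
      have h := hdh.mul hdl
      refine h.congr_of_eventuallyEq (Filter.Eventually.of_forall fun θ => ?_)
      simp only [hgs, Pi.mul_apply, Function.comp]
    -- `g` agrees with `gs` near `θ₀`
    have hev : g =ᶠ[𝓝 θ₀] gs := by
      filter_upwards [hopen.mem_nhds hθ₀] with θ hθ using hggs θ hθ
    have hdg := hdgs.congr_of_eventuallyEq hev
    -- identify the value of the derivative with `k θ₀`
    refine hdg.congr_deriv ?_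
    have hPr : P θ₀ = ‖a + θ₀ • δ‖ ^ 2 := (hx θ₀).symm
    have hP' : 2 * ⟪a, δ⟫_ℝ + ‖δ‖ ^ 2 * (2 * θ₀) = 2 * ⟪a + θ₀ • δ, δ⟫_ℝ := by
      rw [inner_add_left, real_inner_smul_left, real_inner_self_eq_norm_sq]; ring
    have hlin : ⟪a, η⟫_ℝ + θ₀ * ⟪δ, η⟫_ℝ = ⟪a + θ₀ • δ, η⟫_ℝ := by
      rw [inner_add_left, real_inner_smul_left]
    rw [hPr, hP', hlin, hk]
    dsimp only
    rw [Hess₀_polar, deriv_deriv_lennardJones hr, deriv_lennardJones hr]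
    field_simp
    ring
  -- fundamental theorem of calculus on `[0,1]`
  have hint : IntervalIntegrable k MeasureTheory.volume 0 1 :=
    ((intervalIntegrable_Hess₀_chord a δ (δ + η) h0).sub
      (intervalIntegrable_Hess₀_chord a δ (δ - η) h0)).div_const 4
  have hftc := intervalIntegral.integral_eq_sub_of_hasDerivAt
    (fun θ hθ => hderiv θ (h0 θ (by rwa [Set.uIcc_of_le zero_le_one] at hθ))) hint
  have hg1 : g 1 = ⟪(deriv lennardJones ‖a + δ‖ / ‖a + δ‖) • (a + δ), η⟫_ℝ := by simp [hg]
  have hg0 : g 0 = ⟪(deriv lennardJones ‖a‖ / ‖a‖) • a, η⟫_ℝ := by simp [hg]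
  rw [inner_sub_left, ← hg1, ← hg0, ← hftc, hk]
  dsimp only
  rw [intervalIntegral.integral_div, intervalIntegral.integral_sub
    (intervalIntegrable_Hess₀_chord a δ (δ + η) h0) (intervalIntegrable_Hess₀_chord a δ (δ - η) h0)]
  rfl

/-- **Discrete product rule (integrated form)**: along a chord avoiding the origin, with `δ = x − y`,
`secHess a δ (αx − βy) = ⟪F(a+δ) − F(a), α²x − β²y⟫ + ¼(α−β)²(secHess a δ (x+y) − secHess a δ (x−y))`.
This is the per-bond identity behind the linear Caccioppoli inequality for the difference `w` of two
equilibria (`x = w_p`, `y = w_q`, `α = χ_p`, `β = χ_q`). [folklore] -/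
theorem flatDiff_secHess_cutoff_identity (a x y : (EuclideanSpace ℝ (Fin 3))) (α β : ℝ)
    (h0 : ∀ θ ∈ Set.Icc (0 : ℝ) 1, a + θ • (x - y) ≠ 0) :
    secHess a (x - y) (α • x - β • y) =
      ⟪(deriv lennardJones ‖a + (x - y)‖ / ‖a + (x - y)‖) • (a + (x - y)) -
          (deriv lennardJones ‖a‖ / ‖a‖) • a, α ^ 2 • x - β ^ 2 • y⟫_ℝ +
        (α - β) ^ 2 / 4 * (secHess a (x - y) (x + y) - secHess a (x - y) (x - y)) := by
  rw [inner_force_sub_force_eq a (x - y) (α ^ 2 • x - β ^ 2 • y) h0]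
  unfold secHess
  have hI := fun ξ => intervalIntegrable_Hess₀_chord a (x - y) ξ h0
  rw [← intervalIntegral.integral_sub (hI _) (hI _), ← intervalIntegral.integral_div,
    ← intervalIntegral.integral_sub (hI _) (hI _), ← intervalIntegral.integral_const_mul,
    ← intervalIntegral.integral_add]
  · refine intervalIntegral.integral_congr fun θ _ => ?_
    exact Hess₀_cutoff_identity _ _ _ _ _
  · exact ((hI _).sub (hI _)).div_const 4
  · exact ((hI _).sub (hI _)).const_mul _

/-- Registered form of `flatDiff_secHess_cutoff_identity` (sub-goal of crux stmt-AtomisticToContinuum-9332, line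
`Sketch`): the per-bond discrete product rule of the linear Caccioppoli step. [folklore] -/
theorem hcpLiouville_secHess_cutoff_identity : ∀ (a x y : (EuclideanSpace ℝ (Fin 3))) (α β : ℝ), (∀ θ ∈ Set.Icc (0 : ℝ) 1, a + θ • (x - y) ≠ 0) → secHess a (x - y) (α • x - β • y) = ⟪(deriv lennardJones ‖a + (x - y)‖ / ‖a + (x - y)‖) • (a + (x - y)) - (deriv lennardJones ‖a‖ / ‖a‖) • a, α ^ 2 • x - β ^ 2 • y⟫_ℝ + (α - β) ^ 2 / 4 * (secHess a (x - y) (x + y) - secHess a (x - y) (x - y)) := by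
  intro a x y α β h0
  exact flatDiff_secHess_cutoff_identity a x y α β h0

end Summit.AtomisticToContinuum.Crystallization.Theorems.ExcessDecayLiouville

end
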